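import Summits.PneNP.PneNP.Theorems.ChebyshevTracialDesignBalancedSlabRigidity
import Summits.PneNP.PneNP.Theorems.ChebyshevTracialDesignPairContainmentCells
import Literature.Combinatorics.Optimization.SliceJuntaGramFactorization
import Literature.Computability.Complexity.ApproximateDegreeDuality
import HarnessLib

/-!
# Cell pnp-psdrank, route `ChebyshevTracialDesign`: CUT-SIDE JUNTAS ARE LOW-DEGREE, NONNEGATIVE JUNTA MASKS ARE SUMS OF LOW-DEGREE SQUARES —
# every nonnegative mask depending on `U ∩ J` only, `|J| + 2 ≤ D`, is EXACT for (CG_1') at EVERY matching and in EVERY direction; the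
# balanced-slab rigidity of brick 107 at the sharp junta size `|H₁| + |H₂| + 2 ≤ D` (crux `TracialDecayExp20`, stmt-PneNP-19878)

Brick 109 (prover g20; HANDOFF prover g19 FINAL 'IF RE-SPAWNED (c)', MEMO-22 §1(d)/§2(b)). The (CG_1') pair-containment form of a mask
`f : cuts → ℝ` at a matching `M` in direction `v` is `Q^f_M(v) = Σ_U W(U,M) f(U)·C_v(U)²`, `C_v(U) = Σ_p v_p x_p x_{π_M p}`. Brick 103
(`…PairContainmentCells.containment_sosMask_nonpos`) prices `f = Σ_l g_l²` with all `g_l` of Johnson degree `≤ j`, `j + 2 ≤ D`, at `≤ 0` for EVERY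
`M` and EVERY `v`; brick 107 (`…BalancedSlabRigidity`) treated the balanced slabs `1[|U∩H₁| = |U∩H₂|]` through junta virtual positivity on the
DOUBLED window `H ∪ π_M(H)` (hypothesis `2(|H₁|+|H₂|) ≤ D`, direction `χ_{H₁} − χ_{H₂}` only). This file supplies the two bookkeeping lemmas that
were missing and draws the consequences:
* §1 **`inter_eq_of_coords_eq`**, **`exists_cubeRep_of_junta`**, **`mem_lowSpan_of_junta`** — a cut function depending only on `U ∩ J` factors
  through the coordinate vector `z_J(U) ∈ {0,1}^{|J|}` and lies in the span of the containment indicators `1[A' ⊆ U]`, `|A'| ≤ |J|` (every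
  function on `{0,1}^{|J|}` has degree `≤ |J|`, Literature `hasDegreeLE_card`, pulled back to the slice by `hasDegreeLEOn_comp_restrictToCoords` /
  `mem_span_containment_of_hasDegreeLEOn`).
* §2 **`exists_sos_of_nonneg_junta`** — a NONNEGATIVE `J`-junta is a sum of squares of cut functions of Johnson degree `≤ |J|` (the Literature
  Sakaue–Takeda–Kim–Ito certificate on `{0,1}^{|J|}`, `sliceSos_of_junta`, at cube degree `|J|`: `⌈(|J|+|J|−1)/2⌉ = |J|`).
* §3 **`containment_juntaMask_nonpos`** — for an exact design of degree `D` and a nonnegative `J`-junta mask with `|J| + 2 ≤ D`,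
  `2(|J|+2) ≤ t+1`: `Q^f_M(v) ≤ 0` for EVERY perfect matching `M` and EVERY `v : Fin n → ℝ` (no Boolean hypothesis, no restriction on the
  direction, no doubling of the window); `containment_juntaBoolMask_nonpos` records the {0,1} case by name.
* §4 **`balancedSlab_value_nonpos_sharp`**, **`balancedSlab_value_eq_zero_sharp`** — the balanced slabs `f = 1[|U∩H₁| = |U∩H₂|]` with
  `|H₁| + |H₂| + 2 ≤ D`, `2(|H₁|+|H₂|+2) ≤ t+1` have `Q^f_M(v) ≤ 0` for every `M`, `v`, and `Q^f_M(χ_{H₁}−χ_{H₂}) = 0` for EVERY `M` (mean zero by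
  brick 105 `sum_containment_sq_eq_zero_of_slab`): brick 107's exact rigidity at half the window cost, the per-matching junta reach of the
  Literature half-degree law.
READING (MEMO-23 §1): the per-matching EXACT cell of (CG_1') is «nonnegative juntas of size `≤ D − 2`, all directions»; beyond size `D − 2` a junta
mask's shell profile has degree `> D` in the level and only its smoothness (the design's Newton remainder, Literature `ExactDesignRemainder`) can
make `Q^f_M` small.
[cite: Grigoriev2001, Lemma 1.4 (PDF p. 8)] [cite: Rothvoss2017, §2 (PDF p. 6)] [cite: SakaueEtAl2017, main theorem (as quoted in KurpiszLeppanenMastrolilli2016 §1 p. 3)]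
[cite: FilmusIhringer2019, §2 (p. 4)] [cite: GriblingDelaatLaurent2019, §5]
Stature: support/instrument (kernel lane, no defs, axioms standard). WHAT THIS IS NOT: nothing on juntas of size `> D − 2` or on non-junta masks,
no proof or refutation of `TracialDecayExp20`, nothing on psd rank of P_PM(K_n), no P-vs-NP content. Supports stmt-PneNP-19878.
-/

set_option linter.dupNamespace false -- `Summit.PneNP.PneNP.…`: summit = sub-problem (D-0017)

noncomputable section

namespace Summit.PneNP.PneNP.Theorems.ChebyshevTracialDesignCutJuntaMasks

open Finset Matrix Literature.Barriers.PneNP Literature.Combinatorics.Optimization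
open Literature.Computability.Complexity.ApproximateDegree (hasDegreeLE_card)
open Summit.PneNP.PneNP.Theorems.ChebyshevTracialDesignPairContainmentCells (containment_sosMask_nonpos)
open Summit.PneNP.PneNP.Theorems.ChebyshevTracialDesignPairContainmentMean (sum_containment_sq_eq_zero_of_slab)
open Summit.PneNP.PneNP.Theorems.ChebyshevTracialDesignBalancedSlabRigidity (sum_indicator_sub_eq)

variable {n : ℕ}

/-! ### §1 Cut-side juntas factor through the cube `{0,1}^{|J|}` and are low-degree -/

/-- Two sets with the same coordinate vector along `J` (`z_J(U)_i = [j_i ∈ U]`, `j_i` the increasing enumeration of `J`) have the same trace on `J`.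
[cite: FilmusIhringer2019, §2 (p. 4: restriction x|_I)] -/
theorem inter_eq_of_coords_eq (J U U' : Finset (Fin n))
    (h : (fun i : Fin J.card => decide (J.orderEmbOfFin rfl i ∈ U)) = fun i : Fin J.card => decide (J.orderEmbOfFin rfl i ∈ U')) :
    U ∩ J = U' ∩ J := by
  classical
  have key : ∀ p ∈ J, (p ∈ U ↔ p ∈ U') := by
    intro p hpJ
    have hp : p ∈ Set.range (J.orderEmbOfFin rfl) := by rw [Finset.range_orderEmbOfFin]; exact hpJ
    obtain ⟨i, rfl⟩ := hp
    have hi := congrFun h i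
    simpa using hi
  ext p
  simp only [mem_inter]
  constructor
  · rintro ⟨hpU, hpJ⟩; exact ⟨(key p hpJ).1 hpU, hpJ⟩
  · rintro ⟨hpU', hpJ⟩; exact ⟨(key p hpJ).2 hpU', hpJ⟩

/-- **A `J`-junta on the odd cuts factors through the cube `{0,1}^{|J|}`**: there is `q : {0,1}^{|J|} → ℝ` with `g(U) = q(z_J(U))` for every odd
cut `U`, taking only values of `g` and `0` (so `q ≥ 0` when `g ≥ 0`). [cite: FilmusIhringer2019, §2 (p. 4)] -/
theorem exists_cubeRep_of_junta (J : Finset (Fin n)) (g : OddSet n → ℝ) (hg : ∀ U U' : OddSet n, U.1 ∩ J = U'.1 ∩ J → g U = g U') :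
    ∃ q : (Fin J.card → Bool) → ℝ, (∀ U : OddSet n, g U = q (fun i : Fin J.card => decide (J.orderEmbOfFin rfl i ∈ U.1))) ∧
      ∀ z, (∃ U : OddSet n, q z = g U) ∨ q z = 0 := by
  classical
  refine ⟨fun z => if h : ∃ U : OddSet n, (fun i : Fin J.card => decide (J.orderEmbOfFin rfl i ∈ U.1)) = z then g h.choose else 0,
    fun U => ?_, fun z => ?_⟩
  · have h : ∃ U' : OddSet n, (fun i : Fin J.card => decide (J.orderEmbOfFin rfl i ∈ U'.1)) =
        fun i : Fin J.card => decide (J.orderEmbOfFin rfl i ∈ U.1) := ⟨U, rfl⟩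
    show g U = (if h : ∃ U' : OddSet n, (fun i : Fin J.card => decide (J.orderEmbOfFin rfl i ∈ U'.1)) =
        fun i : Fin J.card => decide (J.orderEmbOfFin rfl i ∈ U.1) then g h.choose else 0)
    rw [dif_pos h]
    exact hg U h.choose (inter_eq_of_coords_eq J U.1 h.choose.1 h.choose_spec.symm)
  · by_cases h : ∃ U : OddSet n, (fun i : Fin J.card => decide (J.orderEmbOfFin rfl i ∈ U.1)) = z
    · exact Or.inl ⟨h.choose, by simp only [dif_pos h]⟩
    · exact Or.inr (by simp only [dif_neg h])

/-- **CUT-SIDE JUNTAS ARE LOW-DEGREE.** A function on the odd cuts of `K_n` depending only on `U ∩ J` lies in the real span of the containment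
indicators `1[A' ⊆ U]` with `|A'| ≤ |J|` (every function on `{0,1}^{|J|}` has multilinear degree `≤ |J|`; pull back along `U ↦ z_J(U)`).
[cite: FilmusIhringer2019, §2 (p. 4: degree on a domain)] [cite: LeeRaghavendraSteurer2015, §5 (low-degree functions)] -/
theorem mem_lowSpan_of_junta (J : Finset (Fin n)) (g : OddSet n → ℝ) (hg : ∀ U U' : OddSet n, U.1 ∩ J = U'.1 ∩ J → g U = g U') :
    g ∈ Submodule.span ℝ (Set.range fun A' : {A' : Finset (Fin n) // A'.card ≤ J.card} =>
      fun U : OddSet n => if A'.1 ⊆ U.1 then (1 : ℝ) else 0) := by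
  obtain ⟨q, hq, -⟩ := exists_cubeRep_of_junta J g hg
  have hfun : g = fun U : OddSet n => (fun S : Finset (Fin n) => q (fun i : Fin J.card => decide (J.orderEmbOfFin rfl i ∈ S))) U.1 :=
    funext fun U => hq U
  rw [hfun]
  exact mem_span_containment_of_hasDegreeLEOn (hasDegreeLEOn_comp_restrictToCoords J (hasDegreeLE_card q) univ)

/-! ### §2 Nonnegative juntas are sums of low-degree squares -/

/-- **A NONNEGATIVE `J`-JUNTA IS A SUM OF SQUARES OF JOHNSON DEGREE `≤ |J|`.** If `f ≥ 0` on the odd cuts depends only on `U ∩ J`, then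
`f = Σ_l g_l²` with every `g_l` in the span of the indicators `1[A' ⊆ U]`, `|A'| ≤ |J|` (Sakaue–Takeda–Kim–Ito on `{0,1}^{|J|}` at cube degree `|J|`,
pulled back to the slice). [cite: SakaueEtAl2017, main theorem (as quoted in KurpiszLeppanenMastrolilli2016 §1 p. 3)] [cite: FilmusIhringer2019, §2 (p. 4)] -/
theorem exists_sos_of_nonneg_junta (J : Finset (Fin n)) (f : OddSet n → ℝ) (hf : ∀ U U' : OddSet n, U.1 ∩ J = U'.1 ∩ J → f U = f U')
    (hf0 : ∀ U, 0 ≤ f U) :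
    ∃ (L : ℕ) (g : Fin L → OddSet n → ℝ),
      (∀ l, g l ∈ Submodule.span ℝ (Set.range fun A' : {A' : Finset (Fin n) // A'.card ≤ J.card} =>
        fun U : OddSet n => if A'.1 ⊆ U.1 then (1 : ℝ) else 0)) ∧
      ∀ U : OddSet n, f U = ∑ l, g l U ^ 2 := by
  obtain ⟨q, hq, hq0⟩ := exists_cubeRep_of_junta J f hf
  have hqnn : ∀ z, 0 ≤ q z := fun z => by
    rcases hq0 z with ⟨U, hU⟩ | h0
    · rw [hU]; exact hf0 U
    · rw [h0]
  obtain ⟨L, h, hdeg, hsq⟩ := sliceSos_of_junta J q hqnn (hasDegreeLE_card q) univ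
  have hJ : (J.card + J.card) / 2 = J.card := by omega
  refine ⟨L, fun l U => h l U.1, fun l => ?_, fun U => ?_⟩
  · have hl := hdeg l
    rw [hJ] at hl
    exact mem_span_containment_of_hasDegreeLEOn hl
  · rw [hq U]
    exact hsq U.1 (mem_univ _)

/-! ### §3 Nonnegative junta masks of size `≤ D − 2` are exact for (CG_1'), per matching, in every direction -/

/-- **NONNEGATIVE JUNTA MASKS ARE EXACT FOR (CG_1'), PER MATCHING, IN EVERY DIRECTION.** For an exact design `(n, t, T, D, B_v, C, w)`, a vertex
set `J` with `|J| + 2 ≤ D` and `2(|J|+2) ≤ t+1`, a mask `f ≥ 0` on the odd cuts depending only on `U ∩ J`, EVERY perfect matching `M` and EVERY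
`v : Fin n → ℝ`: `Σ_U W(U,M)·f(U)·(Σ_p v_p x_p x_{π_M p})² ≤ 0`. [cite: Grigoriev2001, Lemma 1.4 (PDF p. 8)] [cite: Rothvoss2017, §2 (PDF p. 6)]
[cite: SakaueEtAl2017, main theorem (as quoted in KurpiszLeppanenMastrolilli2016 §1 p. 3)] -/
theorem containment_juntaMask_nonpos {t T D : ℕ} {Bv : ℝ} {C : Finset ℕ} {w : ℕ → ℝ} (hdes : IsExactDesign n t T D Bv C w)
    (J : Finset (Fin n)) (hJD : J.card + 2 ≤ D) (hJt : 2 * (J.card + 2) ≤ t + 1)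
    (f : OddSet n → ℝ) (hf : ∀ U U' : OddSet n, U.1 ∩ J = U'.1 ∩ J → f U = f U') (hf0 : ∀ U, 0 ≤ f U)
    (M : PMatch n) (v : Fin n → ℝ) :
    ∑ U : OddSet n, levelWeight n t C w U M * (f U *
      (∑ p, v p * ((if p ∈ U.1 then (1 : ℝ) else 0) * (if M.2.partner p ∈ U.1 then (1 : ℝ) else 0))) ^ 2) ≤ 0 := by
  obtain ⟨L, g, hg, hfg⟩ := exists_sos_of_nonneg_junta J f hf hf0
  have h := containment_sosMask_nonpos hdes hJD hJt g hg M v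
  simp_rw [← hfg] at h
  exact h

/-- The {0,1} case by name: a junta INDICATOR mask `f ∈ {0,1}` depending only on `U ∩ J`, `|J| + 2 ≤ D`, `2(|J|+2) ≤ t+1`, has `Q^f_M(v) ≤ 0` for
every `M`, `v`. [cite: Grigoriev2001, Lemma 1.4 (PDF p. 8)] [cite: Rothvoss2017, §2 (PDF p. 6)] -/
theorem containment_juntaBoolMask_nonpos {t T D : ℕ} {Bv : ℝ} {C : Finset ℕ} {w : ℕ → ℝ} (hdes : IsExactDesign n t T D Bv C w)
    (J : Finset (Fin n)) (hJD : J.card + 2 ≤ D) (hJt : 2 * (J.card + 2) ≤ t + 1)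
    (f : OddSet n → ℝ) (hf : ∀ U U' : OddSet n, U.1 ∩ J = U'.1 ∩ J → f U = f U') (hf01 : ∀ U, f U = 0 ∨ f U = 1)
    (M : PMatch n) (v : Fin n → ℝ) :
    ∑ U : OddSet n, levelWeight n t C w U M * (f U *
      (∑ p, v p * ((if p ∈ U.1 then (1 : ℝ) else 0) * (if M.2.partner p ∈ U.1 then (1 : ℝ) else 0))) ^ 2) ≤ 0 :=
  containment_juntaMask_nonpos hdes J hJD hJt f hf (fun U => by rcases hf01 U with h | h <;> simp [h]) M v

/-! ### §4 Balanced-slab rigidity at the sharp junta size -/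

/-- The balanced-slab mask `1[|U∩H₁| = |U∩H₂|]` depends only on `U ∩ (H₁ ∪ H₂)`. [folklore] -/
theorem balancedSlab_junta (H₁ H₂ : Finset (Fin n)) (U U' : OddSet n) (h : U.1 ∩ (H₁ ∪ H₂) = U'.1 ∩ (H₁ ∪ H₂)) :
    (if (U.1 ∩ H₁).card = (U.1 ∩ H₂).card then (1 : ℝ) else 0) = (if (U'.1 ∩ H₁).card = (U'.1 ∩ H₂).card then (1 : ℝ) else 0) := by
  have h1 : U.1 ∩ H₁ = U'.1 ∩ H₁ := by
    have := congrArg (fun S => S ∩ H₁) h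
    simp only [inter_assoc] at this
    rwa [show (H₁ ∪ H₂) ∩ H₁ = H₁ from inter_eq_right.2 subset_union_left] at this
  have h2 : U.1 ∩ H₂ = U'.1 ∩ H₂ := by
    have := congrArg (fun S => S ∩ H₂) h
    simp only [inter_assoc] at this
    rwa [show (H₁ ∪ H₂) ∩ H₂ = H₂ from inter_eq_right.2 subset_union_right] at this
  rw [h1, h2]

/-- **Balanced slabs at the sharp junta size are nonpositive per matching, in EVERY direction**: for an exact design of degree `D` and vertex sets
with `|H₁| + |H₂| + 2 ≤ D`, `2(|H₁|+|H₂|+2) ≤ t+1`, every `M` and every `v`: `Σ_U W(U,M)·1[|U∩H₁| = |U∩H₂|]·(Σ_p v_p x_p x_{π_M p})² ≤ 0`.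
[cite: Grigoriev2001, Lemma 1.4 (PDF p. 8)] [cite: Rothvoss2017, §2 (PDF p. 6)] -/
theorem balancedSlab_value_nonpos_sharp {t T D : ℕ} {Bv : ℝ} {C : Finset ℕ} {w : ℕ → ℝ} (hdes : IsExactDesign n t T D Bv C w)
    (H₁ H₂ : Finset (Fin n)) (hD : H₁.card + H₂.card + 2 ≤ D) (ht : 2 * (H₁.card + H₂.card + 2) ≤ t + 1) (M : PMatch n) (v : Fin n → ℝ) :
    ∑ U : OddSet n, levelWeight n t C w U M * ((if (U.1 ∩ H₁).card = (U.1 ∩ H₂).card then (1 : ℝ) else 0) *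
      (∑ p, v p * ((if p ∈ U.1 then (1 : ℝ) else 0) * (if M.2.partner p ∈ U.1 then (1 : ℝ) else 0))) ^ 2) ≤ 0 := by
  have hJ : (H₁ ∪ H₂).card ≤ H₁.card + H₂.card := card_union_le _ _
  exact containment_juntaBoolMask_nonpos hdes (H₁ ∪ H₂) (by omega) (by omega)
    (fun U : OddSet n => if (U.1 ∩ H₁).card = (U.1 ∩ H₂).card then (1 : ℝ) else 0) (balancedSlab_junta H₁ H₂)
    (fun U => by by_cases h : (U.1 ∩ H₁).card = (U.1 ∩ H₂).card <;> simp [h]) M v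

/-- **SMALL BALANCED SLABS ARE EXACTLY RIGID, SHARP FORM.** For an exact design of degree `D` and vertex sets `H₁, H₂` with `|H₁| + |H₂| + 2 ≤ D`,
`2(|H₁|+|H₂|+2) ≤ t+1`, for EVERY perfect matching `M`: `Σ_U W(U,M)·1[|U∩H₁| = |U∩H₂|]·(Σ_p (1_{H₁}−1_{H₂})(p) x_p x_{π_M p})² = 0` (each term
`≤ 0` by §3, and the sum over `M` vanishes: the slab is mean-zero, brick 105). Brick 107 needed `2(|H₁|+|H₂|) ≤ D`.
[cite: Grigoriev2001, Lemma 1.4 (PDF p. 8)] [cite: Rothvoss2017, §2 (PDF p. 6)] [cite: GriblingDelaatLaurent2019, §5] -/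
theorem balancedSlab_value_eq_zero_sharp {t T D : ℕ} {Bv : ℝ} {C : Finset ℕ} {w : ℕ → ℝ} (hdes : IsExactDesign n t T D Bv C w)
    (H₁ H₂ : Finset (Fin n)) (hD : H₁.card + H₂.card + 2 ≤ D) (ht : 2 * (H₁.card + H₂.card + 2) ≤ t + 1) (M : PMatch n) :
    ∑ U : OddSet n, levelWeight n t C w U M * ((if (U.1 ∩ H₁).card = (U.1 ∩ H₂).card then (1 : ℝ) else 0) *
      (∑ p, ((if p ∈ H₁ then (1 : ℝ) else 0) - (if p ∈ H₂ then (1 : ℝ) else 0)) *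
        ((if p ∈ U.1 then (1 : ℝ) else 0) * (if M.2.partner p ∈ U.1 then (1 : ℝ) else 0))) ^ 2) = 0 := by
  classical
  have hslab : ∀ U : OddSet n, ∑ p ∈ U.1, ((if p ∈ H₁ then (1 : ℝ) else 0) - (if p ∈ H₂ then (1 : ℝ) else 0)) ≠ 0 →
      (if (U.1 ∩ H₁).card = (U.1 ∩ H₂).card then (1 : ℝ) else 0) = 0 := by
    intro U hU
    rw [sum_indicator_sub_eq] at hU
    rw [if_neg]
    intro heq
    exact hU (by rw [heq, sub_self])
  have hsum := sum_containment_sq_eq_zero_of_slab hdes (by omega)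
    (fun U : OddSet n => if (U.1 ∩ H₁).card = (U.1 ∩ H₂).card then (1 : ℝ) else 0)
    (fun p => (if p ∈ H₁ then (1 : ℝ) else 0) - (if p ∈ H₂ then (1 : ℝ) else 0)) hslab
  have hle : ∀ M' ∈ (univ : Finset (PMatch n)), ∑ U : OddSet n, levelWeight n t C w U M' *
      ((if (U.1 ∩ H₁).card = (U.1 ∩ H₂).card then (1 : ℝ) else 0) *
        (∑ p, ((if p ∈ H₁ then (1 : ℝ) else 0) - (if p ∈ H₂ then (1 : ℝ) else 0)) *
          ((if p ∈ U.1 then (1 : ℝ) else 0) * (if M'.2.partner p ∈ U.1 then (1 : ℝ) else 0))) ^ 2) ≤ 0 :=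
    fun M' _ => balancedSlab_value_nonpos_sharp hdes H₁ H₂ hD ht M' _
  exact (sum_eq_zero_iff_of_nonpos hle).1 hsum M (mem_univ _)

end Summit.PneNP.PneNP.Theorems.ChebyshevTracialDesignCutJuntaMasks
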